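import Summits.QuantumFields.YangMills.Theorems.Instrument.AbstractPolymerTailBound
import Literature.MathematicalPhysics.QuantumFieldTheory.ConstructiveQFTWave0
import HarnessLib

/-!
# Instrument cell `ym-instrument`, crew (b): the T2′ tail ON THE TORUS `(ℤ/L)⁴` — the plaquettes of the periodic lattice form an incidence system with `≤ 4` links per plaquette and
# `≤ 6` plaquettes per link, so `AbstractPolymerTailBound.admClosedCount_le_T2` gives `N^T_α(n; f) ≤ (7/10)·(299/20)^n` for the (G1) free-link class of every EVEN torus (reading (β-torus))

QUESTIONS.md: Q-B2 (S2-SPEC v0.5.1 §0: the row is assembled in reading (β-torus) = fine torus `(ℤ/2S₀)⁴`; RADIUS-DERIVATION v0.6.2 (7.0)(b): «the T2′ tail … holds there by the local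
encoding» — typed here); cell `run/shared/lean/pub/ym-instrument/`, HUMAN RULING D-0084 (2), director-ym R138.  HONEST FRAMING (page 1, binding).  WHAT IS CERTIFIED HERE AND AT WHICH
`(G, D, L, β)`: PURE COMBINATORICS of the periodic lattice `(ℤ/L)⁴` (`Literature…QuantumFieldTheory.{Site, Edge, Plaquette} 4 L` — the types behind `GaugeConfig 4 L G` and
`GaugeBlockAveraging.axial 2 S₀`, hence behind the consumer's `FiniteTorusEnclosure`), ANY `L ≥ 1`: the torus plaquette–link incidence system `torusSystem L` (`tEdges`; `≤ 6`
plaquettes through a link by the explicit reconstruction `recover`, as `LatticeGaugeDobrushin.card_plaquettesTouching_singleton_le` on `ℤ⁴`), the comb-gauge AXIS∕FREE links of the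
torus (`IsAxisLinkT`: every transverse coordinate has even representative `ZMod.val`; meaningful for EVEN `L = 2S₀`, where parity is `L`-periodic), the torus (G1) count
`freePolymerCountT L f n`, and ★ `freePolymerCountT_le_T2 : freePolymerCountT L f n ≤ (7/10)·(299/20)^n` for every free torus link `f`, every `n`, every `L` (`NeZero L`).  WHAT THIS
IS NOT: not the torus census IDENTITY with `ℤ⁴` (Lemma W (7.0), untyped), not a KP window on the torus (the activity column and the criterion object are separate), no census zeros on
the torus (the `ℤ⁴` zeros `n ≤ 3` are NOT transported here); NOT a statement about any gauge theory; NOT summit-bearing.  Grade (T).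
-/

noncomputable section

open Finset
open Summit.QuantumFields.YangMills.Theorems.Instrument.AbstractPolymerKraft (IncidenceSystem links atLink IsAdmConnected AdmClosed)
open Summit.QuantumFields.YangMills.Theorems.Instrument.AbstractPolymerTailBound (admClosedCount_le_T2 admClosedCount_le_kraft)

namespace Summit.QuantumFields.YangMills.Theorems.Instrument.TorusPolymerKraft

/-- Torus sites, links, plaquettes: the `ConstructiveQFTWave0` types `Site d L = Fin d → ZMod L`, `Edge d L = Site d L × Fin d`, `Plaquette d L = Site d L × {p // p.1 < p.2}`. -/
abbrev TSite (L : ℕ) : Type := Literature.MathematicalPhysics.QuantumFieldTheory.Site 4 L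
/-- Torus links. -/
abbrev TEdge (L : ℕ) : Type := Literature.MathematicalPhysics.QuantumFieldTheory.Edge 4 L
/-- Torus plaquettes. -/
abbrev TPlaquette (L : ℕ) : Type := Literature.MathematicalPhysics.QuantumFieldTheory.Plaquette 4 L

variable {L : ℕ}

/-! ## §1 The torus incidence system -/

/-- The four links of the torus plaquette `(x; i, j)`: `(x, i), (x + eᵢ, j), (x + eⱼ, i), (x, j)` (the same pattern as `QuantumLattice.plaquetteEdges` on `ℤ⁴`, with torus addition).
[folklore] -/
def tEdges (p : TPlaquette L) : Finset (TEdge L) :=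
  {(p.1, p.2.1.1), (p.1 + Pi.single p.2.1.1 1, p.2.1.2), (p.1 + Pi.single p.2.1.2 1, p.2.1.1), (p.1, p.2.1.2)}

/-- A torus plaquette has at most four links. [folklore] -/
theorem card_tEdges_le (p : TPlaquette L) : (tEdges p).card ≤ 4 := by
  unfold tEdges
  refine (card_insert_le _ _).trans ?_
  refine (Nat.succ_le_succ (card_insert_le _ _)).trans ?_
  refine (Nat.succ_le_succ (Nat.succ_le_succ (card_insert_le _ _))).trans ?_
  simp

/-- The direction of the plaquette `p` other than that of the link `e`. [folklore] -/
def otherDir (e : TEdge L) (p : TPlaquette L) : Fin 4 := if p.2.1.1 = e.2 then p.2.1.2 else p.2.1.1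

/-- Reconstruction of (the data of) a plaquette through `e` from its other direction and its side. [folklore] -/
def recover (e : TEdge L) (cs : Fin 4 × Bool) : TSite L × (Fin 4 × Fin 4) :=
  (if cs.2 then e.1 else e.1 - Pi.single cs.1 1, (min e.2 cs.1, max e.2 cs.1))

/-- A torus plaquette containing the link `e` is determined by its other direction and its side (`decide (p.1 = e.1)`): the four ways a link lies on a plaquette. [folklore] -/
theorem recover_eq {e : TEdge L} {p : TPlaquette L} (he : e ∈ tEdges p) : recover e (otherDir e p, decide (p.1 = e.1)) = (p.1, p.2.1) := by
  obtain ⟨x, ⟨⟨i, j⟩, hij⟩⟩ := p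
  have hij' : i < j := hij
  have hne : i ≠ j := ne_of_lt hij'
  simp only [tEdges, mem_insert, mem_singleton] at he
  rcases he with rfl | rfl | rfl | rfl
  · simp [recover, otherDir, min_eq_left hij'.le, max_eq_right hij'.le]
  · have hod : otherDir ((x + Pi.single i 1, j) : TEdge L) ((x, ⟨(i, j), hij⟩) : TPlaquette L) = i := by simp [otherDir, hne]
    rw [hod]
    simp only [recover, min_eq_right hij'.le, max_eq_left hij'.le]
    by_cases h : x = x + Pi.single i 1
    · rw [decide_eq_true h]; simp only [if_true]; rw [← h]
    · rw [decide_eq_false h]; simp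
  · have hod : otherDir ((x + Pi.single j 1, i) : TEdge L) ((x, ⟨(i, j), hij⟩) : TPlaquette L) = j := by simp [otherDir]
    rw [hod]
    simp only [recover, min_eq_left hij'.le, max_eq_right hij'.le]
    by_cases h : x = x + Pi.single j 1
    · rw [decide_eq_true h]; simp only [if_true]; rw [← h]
    · rw [decide_eq_false h]; simp
  · simp [recover, otherDir, hne, min_eq_right hij'.le, max_eq_left hij'.le]

/-- The other direction differs from the direction of `e`. [folklore] -/
theorem otherDir_ne (e : TEdge L) (p : TPlaquette L) : otherDir e p ≠ e.2 := by
  have hne : p.2.1.1 ≠ p.2.1.2 := (p.2.2).ne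
  unfold otherDir
  split_ifs with h
  · exact fun h' => hne (h.trans h'.symm)
  · exact h

/-- **At most six torus plaquettes contain a given link** (one for each other direction and each side). [folklore] -/
theorem card_through_le [NeZero L] (e : TEdge L) : (Finset.univ.filter fun p : TPlaquette L => e ∈ tEdges p).card ≤ 6 := by
  classical
  have hmaps : ∀ p ∈ (Finset.univ.filter fun p : TPlaquette L => e ∈ tEdges p),
      (otherDir e p, decide (p.1 = e.1)) ∈ (Finset.univ.erase e.2) ×ˢ (Finset.univ : Finset Bool) :=
    fun p _ => mem_product.2 ⟨mem_erase.2 ⟨otherDir_ne e p, mem_univ _⟩, mem_univ _⟩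
  have hinj : Set.InjOn (fun p : TPlaquette L => (otherDir e p, decide (p.1 = e.1))) ↑(Finset.univ.filter fun p : TPlaquette L => e ∈ tEdges p) := by
    intro p hp p' hp' h
    have h1 := recover_eq (mem_filter.1 (mem_coe.1 hp)).2
    have h2 := recover_eq (mem_filter.1 (mem_coe.1 hp')).2
    have h12 : (p.1, p.2.1) = (p'.1, p'.2.1) := by
      rw [← h1, ← h2]
      exact congrArg (recover e) h
    obtain ⟨hfst, hsnd⟩ := Prod.mk.inj h12
    exact Prod.ext hfst (Subtype.ext hsnd)
  calc (Finset.univ.filter fun p : TPlaquette L => e ∈ tEdges p).card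
      ≤ ((Finset.univ.erase e.2) ×ˢ (Finset.univ : Finset Bool)).card := card_le_card_of_injOn _ hmaps hinj
    _ = 6 := by
        rw [card_product, card_erase_of_mem (mem_univ _), card_univ, Fintype.card_fin, card_univ, Fintype.card_bool]

/-- ★ The torus plaquette–link incidence system of `(ℤ/L)⁴`. [folklore] -/
def torusSystem (L : ℕ) [NeZero L] : IncidenceSystem (TPlaquette L) (TEdge L) where
  edges := tEdges
  card_edges_le := card_tEdges_le
  card_through_le := card_through_le

/-! ## §2 Axis ∕ free links of the torus and the (G1) tail -/

/-- **Axis link of the torus** `(ℤ/L)⁴`, `L` even (reading (β-torus): `L = 2S₀`): `(x, μ)` with every transverse coordinate of even representative (`ZMod.val`; for even `L` this is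
the image of the `ℤ⁴` axis links under the covering map).  Decidable by unfolding. [folklore] -/
abbrev IsAxisLinkT (e : TEdge L) : Prop := ∀ ν : Fin 4, ν ≠ e.2 → Even (e.1 ν).val

/-- **Free link of the torus**: not an axis link. [folklore] -/
abbrev IsFreeLinkT (e : TEdge L) : Prop := ¬ IsAxisLinkT e

/-- **The torus (G1) polymer count** `N^T_α(n; f)`: `n`-plaquette sets of `(ℤ/L)⁴` with `f` among their links, connected through shared free links, every free link in `≥ 2` of them.
[folklore] -/
def freePolymerCountT (L : ℕ) [NeZero L] (f : TEdge L) (n : ℕ) : ℕ :=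
  Nat.card {X : Finset (TPlaquette L) // X.card = n ∧ f ∈ links (torusSystem L) X ∧ IsAdmConnected (torusSystem L) IsFreeLinkT X ∧ AdmClosed (torusSystem L) IsFreeLinkT X}

/-- ★ **T2′ on the torus**: `N^T_α(n; f) ≤ (7/10)·(299/20)^n` for every free torus link `f`, every `n`, every `L ≥ 1`. [folklore] -/
theorem freePolymerCountT_le_T2 [NeZero L] {f : TEdge L} (hf : IsFreeLinkT f) (n : ℕ) : (freePolymerCountT L f n : ℝ) ≤ 7 / 10 * (299 / 20 : ℝ) ^ n := by
  unfold freePolymerCountT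
  exact admClosedCount_le_T2 (torusSystem L) IsFreeLinkT hf n

/-- The sharper constant: `N^T_α(n; f) ≤ (7/10)·((100/19)·(119/100)^6)^n = 0.7·(14.9461…)^n`. [folklore] -/
theorem freePolymerCountT_le_kraft [NeZero L] {f : TEdge L} (hf : IsFreeLinkT f) (n : ℕ) :
    (freePolymerCountT L f n : ℝ) ≤ 7 / 10 * ((100 / 19) * (119 / 100 : ℝ) ^ 6) ^ n := by
  unfold freePolymerCountT
  exact admClosedCount_le_kraft (torusSystem L) IsFreeLinkT hf n

/-- The closed-complex class on the torus (every link `≥ 2`-covered, link-connected) obeys the same bound through any root link (`Adm = ⊤`). [folklore] -/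
theorem closedCountT_le_T2 [NeZero L] (e : TEdge L) (n : ℕ) :
    (Nat.card {X : Finset (TPlaquette L) // X.card = n ∧ e ∈ links (torusSystem L) X ∧ IsAdmConnected (torusSystem L) (fun _ => True) X ∧
      AdmClosed (torusSystem L) (fun _ => True) X} : ℝ) ≤ 7 / 10 * (299 / 20 : ℝ) ^ n :=
  admClosedCount_le_T2 (torusSystem L) (fun _ => True) trivial n

end Summit.QuantumFields.YangMills.Theorems.Instrument.TorusPolymerKraft

end
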